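import Literature.AlgebraicGeometry.CossartPiltant200819.Thm21ProjectiveMorphisms2008
import Literature.AlgebraicGeometry.Resolution.NuEliminationInDim
import Literature.AlgebraicGeometry.Resolution.SurfaceResolutionPermissibleCentres
import Literature.AlgebraicGeometry.Resolution.BlowupsComposition
import Literature.AlgebraicGeometry.Resolution.NormalCrossingsStrictification
import HarnessLib

/-!
# Cossart–Jannsen–Saito, Introduction Thm. 1 in blow-up form (`CossartJannsenSaito2020Sequence`) from the
# `Σ^max`-elimination trunk of the CJS port (Cor. 6.18 + Thm. 6.17, proved in the tree)

Topic: `Literature/AlgebraicGeometry/Resolution`. Bridges only (no new named fact, no `sorry`).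

The tree renders the conclusion of CJS Thm. 1.2 / Introduction Thm. 1 in two vocabularies:

* `CossartJannsenSaito2020Sequence` (`CossartPiltant200819/Thm21ProjectiveMorphisms2008.lean`): a resolution `π : X' → X`
  which is an isomorphism over `Reg X` and an `IsSingularBlowupSequence π` — a composite of blow-ups (universal property,
  `IsBlowup`) in centres lying in the non-regular loci; this is the form in which "[36]" (Lipman 1978) enters the
  Cossart–Piltant 2008 chain (`CP2008.resolutionQuasiProjectiveThreefolds_of_printedLeaves_residuals₀`, argument `h36`);
* `ResolutionSequenceInDim 2` (`SigmaMaxEliminationInDim.lean`): a multiple blow-up as DATA (`CentreSeq X`, chosen blow-ups)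
  with centres over `X ∖ Reg X` and regular last scheme — the conclusion of Cor. 6.18, PROVED in the tree from the
  existence of `Σ^max`-eliminations in dimension `≤ 2` (`resolutionSequenceInDim_of_sigmaMaxEliminationInDim`, every `d`;
  hypothesis `SigmaMaxEliminationInDim 2 ↔ CossartJannsenSaito2020_sigmaMaxElimination`, CJS Thm. 6.28 with 3.10 (1)).

This file proves that the second gives the first:

* `CentreSeq.exists_isBlowup_comp_supported` — Temkin 2008 Lemma 2.1.4 / Stacks 080B iterated: a multiple blow-up of a
  Noetherian scheme with centres over `T` composes to ONE blow-up along an ideal sheaf supported in `T` (Literature twin of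
  the summit-side `Summit.ResolutionOfSingularities.ResolutionOfSingularities.Theorems.CentreSeq.exists_isBlowup_comp_of_centresOver`,
  which Literature files cannot import);
* `CentreSeq.isSingularBlowupSequence_comp_of_centresOver` — hence, with `T = X ∖ Reg X` (centres OVER the singular locus
  of the BASE — weaker than the stagewise `CentresInSingularLocus` of the sibling `CentreSeq.isSingularBlowupSequence_comp`,
  `SurfaceResolutionPermissibleCentres.lean`), the composite IS an `IsSingularBlowupSequence` (of length one);
* `CossartJannsenSaito2020Sequence.of_resolutionSequenceInDim : ResolutionSequenceInDim 2 → CossartJannsenSaito2020Sequence`;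
* `CossartJannsenSaito2020Sequence.of_sigmaMaxElimination`, `.of_nuElimination`, `.of_sigmaMaxEliminationInDim_two`,
  `.of_nuEliminationInDim_two`, `.of_sequencePermissible'` — the blow-up form from each trunk fact of the CJS port.

With these, `CossartJannsenSaito2020Sequence`, the weak form `CossartJannsenSaito2020General`
(`…General_of_sigmaMaxElimination`) and everything downstream of "[36]" hang on the single named fact
`CossartJannsenSaito2020_sigmaMaxElimination` (equivalently the `ν`-wise `CossartJannsenSaito2020_nuElimination`).

NOT here: the converse `CossartJannsenSaito2020Sequence → ResolutionSequenceInDim 2` (an `IsSingularBlowupSequence` uses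
arbitrary blow-ups, a `CentreSeq` the chosen ones; the transport is routine but unused).

## References

* V. Cossart, U. Jannsen, S. Saito, *Desingularization: Invariants and Strategy*, LNM 2270 (2020): Introduction Thm. 1,
  Thm. 1.2, Def. 6.14/6.15, Thm. 6.17, Cor. 6.18, Thm. 6.28. [CossartJannsenSaito2020]
* M. Temkin, *Desingularization of quasi-excellent schemes in characteristic zero*, Adv. Math. 219 (2008), Lemma 2.1.4.
  [Temkin2008]
* The Stacks Project, Tag 080B. [StacksProject]
* J. Lipman, *Desingularization of two-dimensional schemes*, Ann. of Math. 107 (1978). [Lipman1978]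
-/

noncomputable section

open CategoryTheory AlgebraicGeometry TopologicalSpace

universe u

namespace Literature.AlgebraicGeometry.Resolution

/-! ## A multiple blow-up with centres over `T` is one `T`-supported blow-up -/

/-- **Temkin 2008, Lemma 2.1.4, for multiple blow-ups as data** (Stacks 080B iterated): if
`s = (X = X_0 ← Bl_{C_0} X_0 = X_1 ← ⋯ ← X_r)` is a multiple blow-up of a Noetherian scheme `X` whose centres lie over
`T ⊆ X` (`s.CentresOver T`), then the composite `s.comp : X_r → X` is a blowing up of `X` along an ideal sheaf `Q` with
`Supp Q ⊆ T`. Induction on `s`: the empty sequence is the blowing up along `⊤`; for `cons C rest` the rest is a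
`σ_1⁻¹ T`-supported blowing up of the Noetherian `Bl_C(X)` (`isNoetherian_of_isBlowup`) by induction, and
`IsBlowup.exists_isBlowup_comp_supported` composes it with `σ_1`. (Literature twin of the summit-side
`…Theorems.CentreSeq.exists_isBlowup_comp_of_centresOver`.) [cite: Temkin2008, Lemma 2.1.4] -/
theorem CentreSeq.exists_isBlowup_comp_supported :
    ∀ {X : Scheme.{u}} [IsNoetherian X] (s : CentreSeq X) (T : Set X), s.CentresOver T →
      ∃ Q : X.IdealSheafData, IsBlowup s.comp Q ∧ (Q.support : Set X) ⊆ T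
  | X, _, .nil _, T, _ =>
    show ∃ Q : X.IdealSheafData, IsBlowup (𝟙 X) Q ∧ (Q.support : Set X) ⊆ T from
      ⟨⊤, isBlowup_id_top X, by simp⟩
  | X, _, .cons C rest, T, h => by
    obtain ⟨hCT, hrest⟩ := h
    haveI : IsNoetherian (blowup C) := isNoetherian_of_isBlowup (blowup.isBlowup C)
    obtain ⟨Q', hQ', hQ'T⟩ := CentreSeq.exists_isBlowup_comp_supported rest _ hrest
    show ∃ Q : X.IdealSheafData, IsBlowup (rest.comp ≫ blowup.π C) Q ∧ (Q.support : Set X) ⊆ T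
    exact IsBlowup.exists_isBlowup_comp_supported (blowup.π C) C rest.comp Q' T
      (blowup.isBlowup C) hCT hQ' hQ'T

/-- **A multiple blow-up of a Noetherian scheme with centres over `X ∖ Reg X` composes to a (one-step) sequence of blow-ups
in singular centres** (`IsSingularBlowupSequence`, the structure clause of `CossartJannsenSaito2020Sequence`).
[cite: Temkin2008, Lemma 2.1.4] -/
theorem CentreSeq.isSingularBlowupSequence_comp_of_centresOver {X : Scheme.{u}} [IsNoetherian X] (s : CentreSeq X)
    (hs : s.CentresOver (Scheme.regularLocus X)ᶜ) : IsSingularBlowupSequence s.comp := by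
  obtain ⟨Q, hQ, hQs⟩ := CentreSeq.exists_isBlowup_comp_supported s _ hs
  exact IsSingularBlowupSequence.of_isBlowup hQ hQs

/-! ## The blow-up form of CJS Introduction Thm. 1 from the trunk facts of the port -/

/-- **`CossartJannsenSaito2020Sequence` from `ResolutionSequenceInDim 2`** (the conclusion of CJS Cor. 6.18): the composite
of the blow-up sequence is a resolution which is an isomorphism over the open `Reg X` (`exists_isResolution_of_centreSeq`;
`X` excellent hence quasi-excellent) and a one-step sequence of blow-ups in singular centres.
[cite: CossartJannsenSaito2020, Thm. 1.2, Cor. 6.18] -/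
theorem CossartJannsenSaito2020Sequence.of_resolutionSequenceInDim (h : ResolutionSequenceInDim.{u} 2) :
    CossartJannsenSaito2020Sequence.{u} := by
  intro X _ _ hexc hdim
  obtain ⟨s, hs, hreg⟩ := h X hexc (by exact_mod_cast hdim)
  obtain ⟨hres, U, hU, hiso⟩ := exists_isResolution_of_centreSeq hexc.isQuasiExcellent s hs hreg
  exact ⟨s.top, s.comp, hres, CentreSeq.isSingularBlowupSequence_comp_of_centresOver s hs, U, hU, hiso⟩

/-- **`CossartJannsenSaito2020Sequence` from `Σ^max`-eliminations in dimension `≤ 2`** (`SigmaMaxEliminationInDim 2`; Cor. 6.18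
with Thm. 6.17 proved in the tree). [cite: CossartJannsenSaito2020, Cor. 6.18, Thm. 6.17] -/
theorem CossartJannsenSaito2020Sequence.of_sigmaMaxEliminationInDim_two (h : SigmaMaxEliminationInDim.{u} 2) :
    CossartJannsenSaito2020Sequence.{u} :=
  CossartJannsenSaito2020Sequence.of_resolutionSequenceInDim (resolutionSequenceInDim_of_sigmaMaxEliminationInDim 2 h)

/-- **`CossartJannsenSaito2020Sequence` from the single named fact `CossartJannsenSaito2020_sigmaMaxElimination`** (CJS
Thm. 6.28 with Thm. 3.10 (1) and the Def. 6.14 gluing). [cite: CossartJannsenSaito2020, Thm. 6.28, Def. 6.15, Cor. 6.18] -/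
theorem CossartJannsenSaito2020Sequence.of_sigmaMaxElimination (h : CossartJannsenSaito2020_sigmaMaxElimination.{u}) :
    CossartJannsenSaito2020Sequence.{u} :=
  CossartJannsenSaito2020Sequence.of_sigmaMaxEliminationInDim_two (sigmaMaxEliminationInDim_two_iff.mpr h)

/-- **`CossartJannsenSaito2020Sequence` from the `ν`-wise fact CJS Thm. 6.28** (`CossartJannsenSaito2020_nuElimination`).
[cite: CossartJannsenSaito2020, Thm. 6.28, Def. 6.14] -/
theorem CossartJannsenSaito2020Sequence.of_nuElimination (h : CossartJannsenSaito2020_nuElimination.{u}) :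
    CossartJannsenSaito2020Sequence.{u} :=
  CossartJannsenSaito2020Sequence.of_sigmaMaxElimination (CossartJannsenSaito2020_sigmaMaxElimination_of_nuElimination h)

/-- **`CossartJannsenSaito2020Sequence` from `ν`-eliminations in dimension `≤ 2`** (`NuEliminationInDim 2`).
[cite: CossartJannsenSaito2020, Thm. 6.28, Def. 6.14, Cor. 6.18] -/
theorem CossartJannsenSaito2020Sequence.of_nuEliminationInDim_two (h : NuEliminationInDim.{u} 2) :
    CossartJannsenSaito2020Sequence.{u} :=
  CossartJannsenSaito2020Sequence.of_resolutionSequenceInDim (resolutionSequenceInDim_of_nuEliminationInDim 2 h)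

/-- **`CossartJannsenSaito2020Sequence` from the printed-permissible sibling along this route** (same conclusion as the direct
bridge `CossartJannsenSaito2020SequencePermissible.sequence`; recorded for bookkeeping). [cite: CossartJannsenSaito2020, Thm. 1.2] -/
theorem CossartJannsenSaito2020Sequence.of_sequencePermissible' (h : CossartJannsenSaito2020SequencePermissible.{u}) :
    CossartJannsenSaito2020Sequence.{u} :=
  CossartJannsenSaito2020Sequence.of_resolutionSequenceInDim h.resolutionSequenceInDim

/-- **The weak form and the blow-up form together from the single trunk fact**: under
`CossartJannsenSaito2020_sigmaMaxElimination` both `CossartJannsenSaito2020General` and `CossartJannsenSaito2020Sequence` hold.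
[cite: CossartJannsenSaito2020, Thm. 1.2, Thm. 6.28] -/
theorem cossartJannsenSaito2020General_and_sequence_of_sigmaMaxElimination
    (h : CossartJannsenSaito2020_sigmaMaxElimination.{u}) :
    CossartJannsenSaito2020General.{u} ∧ CossartJannsenSaito2020Sequence.{u} :=
  ⟨CossartJannsenSaito2020General_of_sigmaMaxElimination h, CossartJannsenSaito2020Sequence.of_sigmaMaxElimination h⟩

end Literature.AlgebraicGeometry.Resolution

end
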